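import Summits.ResolutionOfSingularities.ResolutionOfSingularities.Theorems.FrobeniusLadderFInjectiveMacaulayficationPointFloorLegalOfIsolated
import Summits.ResolutionOfSingularities.ResolutionOfSingularities.Theorems.FrobeniusLadderFInjectiveMacaulayficationHypersurfaceOriginNotFull
import Summits.ResolutionOfSingularities.ResolutionOfSingularities.Theorems.FrobeniusLadderFInjectiveMacaulayficationIntrinsicTowerRecipes
import HarnessLib

/-!
# Q9⁺ GENERIC POINT-FLOOR NON-FULLNESS: if one strict transform `g_i` of the point blow-up of `X = Spec k[X]/(f)` lies in `𝔫^{[p]}` at its origin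
# (Fedder necessity), then EVERY blowing up of `Spec 𝒪_{X,v}` along `𝔪̃_v` has a NON-FULL stalk over the closed point — any prime `p`, any `n`, any `f`
# (crux `FInjectiveMacaulayfication` stmt-ResolutionOfSingularities-15315, chain w45a; res-L1-w45a-plan-1 g21 RULING R21.5 (3) Q9, the «¬FULL» companion of
# `…PointFloorLegalOfIsolated` — this seat's bed-specific `pointFloor_…_not_full` / `not_recipeTowerFull_zero` / `recipeTowerFull_of_towerTerminates`
# (✓ p639147 / p640621 / p640799 / p647478) made generic; consumers: (W-p3) (`p = 3`, `f² ∈ 𝔪^{[3]}` chartwise), every future point-floor row; seat res-L1-w45a-stub-3 g10)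

[OURS · L1 W4.5a] Support file (`--supports stmt-ResolutionOfSingularities-15315 --as helper`); def-free; UNCONDITIONAL (`RecipeTowerFull` is only NEGATED at height `0`). Replaces the role of NO printed item; NOT a statement of the manuscript;
AI-written (AI review is weaker than expert review).

INPUT BINDERS: as in `PointFloorLegalOfIsolated` (`f` prime, strict transforms `θ_i f = X_i^{μ i} g_i`, `f, g_i ∉ (X_i)`, `v` = origin), plus ONE chart `i₀` whose
strict transform has NO constant term and satisfies Fedder's necessity `g_{i₀}^{p−1} ∈ (X_0^p, …, X_{n−1}^p)` (for a bed: a termwise membership).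
* §1 ★★ `exists_point_over_vertex_not_fullCl` — a point of the model `affineBlowup 𝔪` over `v` whose stalk is NOT `FullCl p` (the origin of the chart `D(x̄_{i₀} t)`:
  `HypersurfaceOriginNotFull.not_fullCl_stalk_origin_of_fedder_mem` transported along `StrictTransformChartN` ∘ `ReesChartFacts` and placed by res-L1-w45a-stub-1's
  `TauFloorInputNotFull.exists_point_over_centre_not_fullCl`); ★★ `pointFloor_not_full` — for EVERY blowing up `g : S′ → Spec 𝒪_{X,v}` along `𝔪̃|`: a point over
  the closed point with a NON-FULL stalk; `not_recipeTowerFull_zero` (positive height for every recipe).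
(The BY-NAME instantiation of `TowerTerminates c` needs the bed's remaining binders — separated / finite type, `v` closed, `dim 𝒪_{X,v} = d ≥ 4` — and stays
  in the bed files, e.g. `Lx6c3PointFloor.recipeTowerFull_of_towerTerminates`.)
[folklore assembly; cite: Fedder1983, Prop. 1.7; GortzWedhorn2020, Prop. 13.91 (2); StacksProject, Tag 0804]
-/

-- single-problem summit: the doubled namespace component is forced
set_option linter.dupNamespace false

noncomputable section

namespace Summit.ResolutionOfSingularities.ResolutionOfSingularities.Theorems.FInjectiveMacaulayfication.PointFloorNotFullOfFedder

open CategoryTheory CategoryTheory.Limits AlgebraicGeometry TopologicalSpace IsLocalRing MvPolynomial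
open Literature.AlgebraicGeometry.Resolution
open Summit.ResolutionOfSingularities.ResolutionOfSingularities.Theorems.FInjectiveMacaulayfication
open SliceableCentre GermOfGlobalBlowup

variable (p : ℕ) [Fact p.Prime] (k : Type) [Field k] [CharP k p] {n : ℕ}

/-! ## §1 ★★ A non-FULL point over the vertex; the point floor is NOT FULL -/

set_option synthInstance.maxHeartbeats 200000 in
set_option maxHeartbeats 1600000 in
-- two ring equivalences onto the blow-up algebra + one localization transport (same budget as the bed files)
/-- ★★ **A point of `Bl_𝔪 X` over the vertex with a NON-FULL stalk**: the origin of the chart `D(x̄_{i₀} t)` — `k[X]/(g_{i₀})` is not FULL at its origin by Fedder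
necessity (`g_{i₀}^{p−1} ∈ 𝔫^{[p]}`); transported along `k[X]/(g_{i₀}) ≃ (A[𝔪t])_{(x̄t)} ≃ A[𝔪/x̄]` and placed on `Bl_𝔪 X`. [OURS · certificate; cite: Fedder1983, Prop. 1.7] -/
theorem exists_point_over_vertex_not_fullCl (f : MvPolynomial (Fin n) k) (hf : Prime f) (μ : Fin n → ℕ) (g : Fin n → MvPolynomial (Fin n) k)
    (hθ : ∀ i : Fin n, aeval (fun j : Fin n => if j = i then (X i : MvPolynomial (Fin n) k) else X j * X i) f = X i ^ μ i * g i)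
    (hfX : ∀ i : Fin n, f ∉ Ideal.span {(X i : MvPolynomial (Fin n) k)}) (hgX : ∀ i : Fin n, g i ∉ Ideal.span {(X i : MvPolynomial (Fin n) k)})
    (hf0 : constantCoeff f = 0) (i₀ : Fin n) (hc : constantCoeff (g i₀) = 0)
    (hfed : g i₀ ^ (p - 1) ∈ Ideal.span (Set.range fun j : Fin n => (X j : MvPolynomial (Fin n) k) ^ p))
    (v : Spec (.of (MvPolynomial (Fin n) k ⧸ Ideal.span {f}))) (hv : v.asIdeal = Ideal.span (Set.range (fun j : Fin n => Ideal.Quotient.mk (Ideal.span {f}) (X j)))) :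
    ∃ b : ↥(affineBlowup (Ideal.span (Set.range (fun j : Fin n => Ideal.Quotient.mk (Ideal.span {f}) (X j))))),
      (affineBlowup.π _).base b = v ∧ ¬ FullCl p ((affineBlowup (Ideal.span (Set.range (fun j : Fin n => Ideal.Quotient.mk (Ideal.span {f}) (X j))))).presheaf.stalk b) := by
  classical
  set i := i₀ with hi
  have hfprime : (Ideal.span {f}).IsPrime := (Ideal.span_singleton_prime hf.ne_zero).mpr hf
  obtain ⟨hgp, hgprime, hXi⟩ := PointFloorLegalOfIsolated.isPrime_span_strictTransform k f hf μ g hθ hfX hgX i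
  -- the chart ring `k[X]/(g_i)` and its identification with `A[𝔪/x̄_i]`
  obtain ⟨e₀, he₀⟩ := StrictTransformChartN.stub_strictTransformChartN k n f (g i) i (μ i) hfprime hf.ne_zero hgprime hXi (hθ i)
    (fun j : Fin n => Ideal.Quotient.mk (Ideal.span {f}) (X j)) rfl
  have hxi : Ideal.Quotient.mk (Ideal.span {f}) (X i) ∈ Ideal.span (Set.range (fun j : Fin n => Ideal.Quotient.mk (Ideal.span {f}) (X j))) := Ideal.subset_span ⟨i, rfl⟩
  obtain ⟨e, he⟩ := ReesChartFacts.exists_reesChartEquiv (Ideal.span (Set.range (fun j : Fin n => Ideal.Quotient.mk (Ideal.span {f}) (X j)))) (Ideal.Quotient.mk (Ideal.span {f}) (X i)) hxi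
  let E := e₀.trans e
  have hE : E (Ideal.Quotient.mk _ (X i)) = algebraMap (MvPolynomial (Fin n) k ⧸ Ideal.span {f}) _ (Ideal.Quotient.mk (Ideal.span {f}) (X i)) := by
    change e (e₀ (Ideal.Quotient.mk _ (X i))) = _
    rw [he₀, he]
  -- the origin of the chart, transported
  haveI hmax : (Ideal.span (Set.range fun j : Fin n => Ideal.Quotient.mk (Ideal.span {g i}) (X j))).IsMaximal := DoublePointFermatCubicGerm.isMaximal_origin k _ hc
  let Q := (Ideal.span (Set.range fun j : Fin n => Ideal.Quotient.mk (Ideal.span {g i}) (X j))).map E.toRingHom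
  haveI hQ : Q.IsPrime := Ideal.map_isPrime_of_equiv E
  have hcomap : Q.comap E.toRingHom = Ideal.span (Set.range fun j : Fin n => Ideal.Quotient.mk (Ideal.span {g i}) (X j)) := Ideal.comap_map_of_bijective E.toRingHom E.bijective
  haveI : (Q.comap E.toRingHom).IsPrime := Ideal.IsPrime.comap _
  -- `x̄_i/1 ∈ Q`
  have hxQ : algebraMap (MvPolynomial (Fin n) k ⧸ Ideal.span {f}) _ (Ideal.Quotient.mk (Ideal.span {f}) (X i)) ∈ Q := by
    rw [← hE]; exact Ideal.mem_map_of_mem _ (Ideal.subset_span ⟨i, rfl⟩)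
  -- `¬ FullCl p` at `Q`
  have hbad : ¬ FullCl p (Localization.AtPrime Q) := by
    intro hfull
    obtain ⟨eQ⟩ := E8Char5FiModel.nonempty_ringEquiv_localization_comap E Q
    let w : Spec (.of (MvPolynomial (Fin n) k ⧸ Ideal.span {g i})) := ⟨Q.comap E.toRingHom, inferInstance⟩
    have hw := HypersurfaceOriginNotFull.not_fullCl_stalk_origin_of_fedder_mem p k _ hgp.ne_zero hc hfed w hcomap
    exact hw (WFixAtNonClosedDimTwo.fullCl_of_ringEquiv p (eQ.symm.trans (Spec.stalkIso (.of _) w).commRingCatIsoToRingEquiv.symm) hfull)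
  obtain ⟨b, hb, hbadb⟩ := TauFloorInputNotFull.exists_point_over_centre_not_fullCl _ _ hxi p Q hxQ hbad
  refine ⟨b, ?_, hbadb⟩
  haveI hvmax : v.asIdeal.IsMaximal := by
    rw [hv]; exact DoublePointFermatCubicGerm.isMaximal_origin k f hf0
  have h1 : v.asIdeal ≤ ((affineBlowup.π _).base b).asIdeal := by rw [hv]; exact hb
  exact (PrimeSpectrum.ext (hvmax.eq_of_le ((affineBlowup.π _).base b).2.ne_top h1)).symm

/-- ★★ **GENERIC POINT-FLOOR NON-FULLNESS**: for every blowing up `g : S′ → Spec 𝒪_{X,v}` along `𝔪̃|` there is a point `s ∈ S′` over the closed point whose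
local ring is NOT `FullCl p`. [OURS · assembly; cite: GortzWedhorn2020, Prop. 13.91 (2)] -/
theorem pointFloor_not_full (f : MvPolynomial (Fin n) k) (hf : Prime f) (μ : Fin n → ℕ) (g : Fin n → MvPolynomial (Fin n) k)
    (hθ : ∀ i : Fin n, aeval (fun j : Fin n => if j = i then (X i : MvPolynomial (Fin n) k) else X j * X i) f = X i ^ μ i * g i)
    (hfX : ∀ i : Fin n, f ∉ Ideal.span {(X i : MvPolynomial (Fin n) k)}) (hgX : ∀ i : Fin n, g i ∉ Ideal.span {(X i : MvPolynomial (Fin n) k)})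
    (hf0 : constantCoeff f = 0) (i₀ : Fin n) (hc : constantCoeff (g i₀) = 0)
    (hfed : g i₀ ^ (p - 1) ∈ Ideal.span (Set.range fun j : Fin n => (X j : MvPolynomial (Fin n) k) ^ p))
    (v : Spec (.of (MvPolynomial (Fin n) k ⧸ Ideal.span {f}))) (hv : v.asIdeal = Ideal.span (Set.range (fun j : Fin n => Ideal.Quotient.mk (Ideal.span {f}) (X j))))
    (S' : Scheme.{0}) (g' : S' ⟶ Spec ((Spec (.of (MvPolynomial (Fin n) k ⧸ Ideal.span {f}))).presheaf.stalk v))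
    (hg' : IsBlowup g' ((affineBlowup.idealSheaf (Ideal.span (Set.range (fun j : Fin n => Ideal.Quotient.mk (Ideal.span {f}) (X j))))).comap ((Spec (.of (MvPolynomial (Fin n) k ⧸ Ideal.span {f}))).fromSpecStalk v))) :
    ∃ s : S', g'.base s = closedPoint ((Spec (.of (MvPolynomial (Fin n) k ⧸ Ideal.span {f}))).presheaf.stalk v) ∧ ¬ FullCl p (S'.presheaf.stalk s) :=
  TauFloorInputNotFull.exists_not_fullCl_of_isBlowup_comap_fromSpecStalk p v (affineBlowup.isBlowup _)
    (exists_point_over_vertex_not_fullCl p k f hf μ g hθ hfX hgX hf0 i₀ hc hfed v hv) hg'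

/-- Hence no recipe tower of height `0` from this floor: `¬ RecipeTowerFull c p 0 S′`, for EVERY centre recipe `c`. [OURS] -/
theorem not_recipeTowerFull_zero (c : IntrinsicTower.Recipes.CentreRecipe) (f : MvPolynomial (Fin n) k) (hf : Prime f) (μ : Fin n → ℕ) (g : Fin n → MvPolynomial (Fin n) k)
    (hθ : ∀ i : Fin n, aeval (fun j : Fin n => if j = i then (X i : MvPolynomial (Fin n) k) else X j * X i) f = X i ^ μ i * g i)
    (hfX : ∀ i : Fin n, f ∉ Ideal.span {(X i : MvPolynomial (Fin n) k)}) (hgX : ∀ i : Fin n, g i ∉ Ideal.span {(X i : MvPolynomial (Fin n) k)})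
    (hf0 : constantCoeff f = 0) (i₀ : Fin n) (hc : constantCoeff (g i₀) = 0)
    (hfed : g i₀ ^ (p - 1) ∈ Ideal.span (Set.range fun j : Fin n => (X j : MvPolynomial (Fin n) k) ^ p))
    (v : Spec (.of (MvPolynomial (Fin n) k ⧸ Ideal.span {f}))) (hv : v.asIdeal = Ideal.span (Set.range (fun j : Fin n => Ideal.Quotient.mk (Ideal.span {f}) (X j))))
    (S' : Scheme.{0}) (g' : S' ⟶ Spec ((Spec (.of (MvPolynomial (Fin n) k ⧸ Ideal.span {f}))).presheaf.stalk v))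
    (hg' : IsBlowup g' ((affineBlowup.idealSheaf (Ideal.span (Set.range (fun j : Fin n => Ideal.Quotient.mk (Ideal.span {f}) (X j))))).comap ((Spec (.of (MvPolynomial (Fin n) k ⧸ Ideal.span {f}))).fromSpecStalk v))) :
    ¬ IntrinsicTower.Recipes.RecipeTowerFull c p 0 S' := by
  intro h0
  obtain ⟨s, -, hs⟩ := pointFloor_not_full p k f hf μ g hθ hfX hgX hf0 i₀ hc hfed v hv S' g' hg'
  exact hs (h0 s)

end Summit.ResolutionOfSingularities.ResolutionOfSingularities.Theorems.FInjectiveMacaulayfication.PointFloorNotFullOfFedder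

end
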